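import Summits.KontsevichZagierPeriods.Zeta5Search.Certificates.TwoTaleOmegaRules

/-!
# ζ(2) two-tale line — assembly: the Ω-induction with the CERTIFIED coefficient tables (cell `pub-zeta5`, certifier `cert-2`)

HONEST FRAMING: systematic search; recurrence certificates; no irrationality claim unless certified.

`TwoTaleOmegaInduction.eq_on_Omega` runs fam-tele's induction (`certs/tele/bmiss_general/PROOF.md` §1) for ABSTRACT coefficients.
Here the coefficients are INSTANTIATED with the kernel-checked certificate tables of the tree: for the six polynomial directions
`g, b, e, f, bg, a` the table `coef` returns the operator coefficient `c_k(p₀)` (`spvalC c<D>k` at the base-point letters — the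
operators of the `telescope_<d>_<X>` identities, the SAME for both sides), and (S3) is DISCHARGED inside the proof: for `g, b, e, f, bg`
from `p₀ ∈ Ω` (`TwoTaleTelescopeLeading` via `c<D>3_ne_zero_of_Omega`), for `a` from `TwoTaleOmegaRules.cA3_ne_zero_of_rules`
provided a-steps are taken as the RULE prescribes (`g`, `b` inapplicable at the target, `a ≥ 17` — hypothesis `hA` on the legitimacy
predicate).  Direction `aef` keeps an abstract coefficient function `cAEF` with its own non-vanishing hypothesis (the tree discharges it on
the 81 families `a ≥ 17` in `TwoTaleTelescopeAefLead*`, indexed by shape).  What `eq_on_Omega_certified` still ASSUMES is exactly the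
analytic layer: the step relations `Σ_k c_k(p₀) I_X(p₀+kδ) = 0` for certified steps (from (S1) = `telescope_*` plus the contour shift
(S2)) and `I_L = I_R` on the base points.  Nothing analytic is proved here.
-/

namespace Summit.KontsevichZagierPeriods.Zeta5Search.Certificates

namespace TwoTaleTelescope

open Finset

/-- Value of a five-letter coefficient table at the letters of a point. -/
def tabAt (c : List (List ℕ)) (p₀ : Pt) : ℤ := spvalC c (p₀ 0) (p₀ 1) (p₀ 2) (p₀ 3) (p₀ 4)

/-- The operator coefficient tables `(c₀, c₁, c₂, c₃)` of the six polynomial directions. -/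
def tabG (k : ℕ) : List (List ℕ) := if k = 0 then cG0 else if k = 1 then cG1 else if k = 2 then cG2 else cG3
/-- See `tabG`. -/
def tabB (k : ℕ) : List (List ℕ) := if k = 0 then cB0 else if k = 1 then cB1 else if k = 2 then cB2 else cB3
/-- See `tabG`. -/
def tabE (k : ℕ) : List (List ℕ) := if k = 0 then cE0 else if k = 1 then cE1 else if k = 2 then cE2 else cE3
/-- See `tabG`. -/
def tabF (k : ℕ) : List (List ℕ) := if k = 0 then cF0 else if k = 1 then cF1 else if k = 2 then cF2 else cF3
/-- See `tabG`. -/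
def tabBG (k : ℕ) : List (List ℕ) := if k = 0 then cBg0 else if k = 1 then cBg1 else if k = 2 then cBg2 else cBg3
/-- See `tabG`. -/
def tabA (k : ℕ) : List (List ℕ) := if k = 0 then cA0 else if k = 1 then cA1 else if k = 2 then cA2 else cA3

/-- The CERTIFIED coefficient function of the Ω-induction: direction `δ`, base point `p₀`, index `k ↦ c_k(p₀)`; the aef direction is
supplied by the caller (`cAEF`), any other vector gets `0`. -/
def coef (cAEF : Pt → ℕ → ℤ) (δ p₀ : Pt) (k : ℕ) : ℤ :=
  if δ = dirG then tabAt (tabG k) p₀ else if δ = dirB then tabAt (tabB k) p₀ else if δ = dirE then tabAt (tabE k) p₀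
  else if δ = dirF then tabAt (tabF k) p₀ else if δ = dirBG then tabAt (tabBG k) p₀ else if δ = dirA then tabAt (tabA k) p₀
  else if δ = dirAEF then cAEF p₀ k else 0

/-- The seven direction vectors are pairwise distinct (the facts needed to evaluate `coef`). -/
theorem dir_ne :
    dirB ≠ dirG ∧ dirE ≠ dirG ∧ dirE ≠ dirB ∧ dirF ≠ dirG ∧ dirF ≠ dirB ∧ dirF ≠ dirE ∧ dirBG ≠ dirG ∧ dirBG ≠ dirB ∧ dirBG ≠ dirE ∧
      dirBG ≠ dirF ∧ dirA ≠ dirG ∧ dirA ≠ dirB ∧ dirA ≠ dirE ∧ dirA ≠ dirF ∧ dirA ≠ dirBG ∧ dirAEF ≠ dirG ∧ dirAEF ≠ dirB ∧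
      dirAEF ≠ dirE ∧ dirAEF ≠ dirF ∧ dirAEF ≠ dirBG ∧ dirAEF ≠ dirA := by
  refine ⟨?_, ?_, ?_, ?_, ?_, ?_, ?_, ?_, ?_, ?_, ?_, ?_, ?_, ?_, ?_, ?_, ?_, ?_, ?_, ?_, ?_⟩ <;>
  · intro h
    have h0 := congrFun h 0; have h1 := congrFun h 1; have h2 := congrFun h 2; have h3 := congrFun h 3; have h4 := congrFun h 4
    simp [dirG, dirB, dirE, dirF, dirA, dirAEF, dirBG] at h0 h1 h2 h3 h4

/-- `coef` on direction `g`. -/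
theorem coef_G (cAEF : Pt → ℕ → ℤ) (p₀ : Pt) (k : ℕ) : coef cAEF dirG p₀ k = tabAt (tabG k) p₀ := by simp [coef]
/-- `coef` on direction `b`. -/
theorem coef_B (cAEF : Pt → ℕ → ℤ) (p₀ : Pt) (k : ℕ) : coef cAEF dirB p₀ k = tabAt (tabB k) p₀ := by simp [coef, dir_ne]
/-- `coef` on direction `e`. -/
theorem coef_E (cAEF : Pt → ℕ → ℤ) (p₀ : Pt) (k : ℕ) : coef cAEF dirE p₀ k = tabAt (tabE k) p₀ := by simp [coef, dir_ne]
/-- `coef` on direction `f`. -/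
theorem coef_F (cAEF : Pt → ℕ → ℤ) (p₀ : Pt) (k : ℕ) : coef cAEF dirF p₀ k = tabAt (tabF k) p₀ := by simp [coef, dir_ne]
/-- `coef` on direction `bg`. -/
theorem coef_BG (cAEF : Pt → ℕ → ℤ) (p₀ : Pt) (k : ℕ) : coef cAEF dirBG p₀ k = tabAt (tabBG k) p₀ := by simp [coef, dir_ne]
/-- `coef` on direction `a`. -/
theorem coef_A (cAEF : Pt → ℕ → ℤ) (p₀ : Pt) (k : ℕ) : coef cAEF dirA p₀ k = tabAt (tabA k) p₀ := by simp [coef, dir_ne]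
/-- `coef` on direction `aef`. -/
theorem coef_AEF (cAEF : Pt → ℕ → ℤ) (p₀ : Pt) (k : ℕ) : coef cAEF dirAEF p₀ k = cAEF p₀ k := by simp [coef, dir_ne]

/-- A certified step has its base point in `Ω` and its target `p₀ + 3δ` applicable for `δ`. -/
theorem stepBase_facts {Legit : Pt → Pt → Prop} {δ p₀ : Pt} (h : p₀ ∈ StepBase Legit δ) :
    p₀ ∈ Omega ∧ p₀ + (3 : ℤ) • δ ∈ App δ := by
  obtain ⟨hδ, hΩ, -⟩ := h
  refine ⟨by simpa using hΩ 0 (by omega), ?_⟩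
  rw [mem_App_iff_stepBase δ hδ, add_sub_cancel_right]
  exact ⟨hδ, hΩ, trivial⟩

/-- **(S3) discharged**: the certified leading coefficient `coef … δ p₀ 3` is non-zero for every certified step, given that a-steps
follow the rule (`hA`) and the caller's aef coefficient is non-zero on certified aef steps (`hAEF`). -/
theorem coef_three_ne_zero (Legit : Pt → Pt → Prop) (cAEF : Pt → ℕ → ℤ)
    (hA : ∀ p₀, Legit dirA p₀ → 17 ≤ p₀ 0 + 3 ∧ p₀ + (3 : ℤ) • dirA ∉ App dirG ∧ p₀ + (3 : ℤ) • dirA ∉ App dirB)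
    (hAEF : ∀ p₀ ∈ StepBase Legit dirAEF, cAEF p₀ 3 ≠ 0) :
    ∀ δ, ∀ p₀ ∈ StepBase Legit δ, coef cAEF δ p₀ 3 ≠ 0 := by
  intro δ p₀ hst
  obtain ⟨hΩ0, happ⟩ := stepBase_facts hst
  have hδ := hst.1
  simp only [dirs, List.mem_cons, List.mem_nil_iff, or_false] at hδ
  rcases hδ with rfl | rfl | rfl | rfl | rfl | rfl | rfl
  · rw [coef_G]; exact cG3_ne_zero_of_Omega p₀ hΩ0
  · rw [coef_B]; exact cB3_ne_zero_of_Omega p₀ hΩ0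
  · rw [coef_E]; exact cE3_ne_zero_of_Omega p₀ hΩ0
  · rw [coef_F]; exact cF3_ne_zero_of_Omega p₀ hΩ0
  · -- direction a: the rule data at the target `p = p₀ + 3·(1,0,0,0,0)`
    rw [coef_A]
    obtain ⟨h17, hg, hb⟩ := hA p₀ hst.2.2
    have hp : p₀ + (3 : ℤ) • dirA ∈ Omega := by simpa using hst.2.1 3 le_rfl
    have key := cA3_ne_zero_of_rules (p₀ + (3 : ℤ) • dirA) hp (by
      have := (shift_A p₀ (-3)).1; simp only [neg_smul, sub_neg_eq_add] at this; omega) hg hb happ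
    have c0 : (p₀ + (3 : ℤ) • dirA) 0 = p₀ 0 + 3 := by simp [dirA]
    have c1 : (p₀ + (3 : ℤ) • dirA) 1 = p₀ 1 := by simp [dirA]
    have c2 : (p₀ + (3 : ℤ) • dirA) 2 = p₀ 2 := by simp [dirA]
    have c3 : (p₀ + (3 : ℤ) • dirA) 3 = p₀ 3 := by simp [dirA]
    have c4 : (p₀ + (3 : ℤ) • dirA) 4 = p₀ 4 := by simp [dirA]
    rw [c0, c1, c2, c3, c4, add_sub_cancel_right] at key
    exact key
  · rw [coef_AEF]; exact hAEF p₀ hst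
  · rw [coef_BG]; exact cBg3_ne_zero_of_Omega p₀ hΩ0

/-- **The Ω-induction with certified coefficients.**  For functions `I_L, I_R : ℤ⁵ → F` (`F` a field of characteristic zero), a
legitimacy predicate under which a-steps follow the rule (`hA`), and an aef coefficient function non-vanishing at `k = 3` on certified
aef steps (`hAEF`): if `I_L = I_R` on the base points and both functions satisfy the certified step relations with the TREE'S
coefficient tables `coef`, then `I_L = I_R` on all of `Ω`.  (S3) for `g, b, e, f, bg, a` is discharged by kernel theorems; the
hypotheses that remain are the analytic step relations and the base. -/
theorem eq_on_Omega_certified {F : Type*} [Field F] [CharZero F] (Legit : Pt → Pt → Prop) (cAEF : Pt → ℕ → ℤ)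
    (IL IR : Pt → F)
    (hA : ∀ p₀, Legit dirA p₀ → 17 ≤ p₀ 0 + 3 ∧ p₀ + (3 : ℤ) • dirA ∉ App dirG ∧ p₀ + (3 : ℤ) • dirA ∉ App dirB)
    (hAEF : ∀ p₀ ∈ StepBase Legit dirAEF, cAEF p₀ 3 ≠ 0)
    (hbase : ∀ p ∈ Base Legit, IL p = IR p)
    (hL : ∀ δ, ∀ p₀ ∈ StepBase Legit δ, ∑ k ∈ range 4, (coef cAEF δ p₀ k : F) * IL (p₀ + (k : ℤ) • δ) = 0)
    (hR : ∀ δ, ∀ p₀ ∈ StepBase Legit δ, ∑ k ∈ range 4, (coef cAEF δ p₀ k : F) * IR (p₀ + (k : ℤ) • δ) = 0) :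
    ∀ p ∈ Omega, IL p = IR p :=
  eq_on_Omega Legit (coef cAEF) IL IR hbase hL hR
    (fun δ p₀ h => Int.cast_ne_zero.mpr (coef_three_ne_zero Legit cAEF hA hAEF δ p₀ h))

end TwoTaleTelescope

end Summit.KontsevichZagierPeriods.Zeta5Search.Certificates
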